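import Mathlib.Analysis.Calculus.ImplicitContDiff
import Mathlib.Analysis.Calculus.FDeriv.Analytic
import Mathlib.Analysis.Calculus.IteratedDeriv.Defs
import Mathlib.Analysis.SpecialFunctions.Complex.Analytic
import Mathlib.Analysis.Complex.Polynomial.Basic
import Literature.Analysis.Complex.SmoothHypersurfaceDivision
import Literature.Analysis.Complex.HolomorphicBanach
import HarnessLib

/-!
# The holomorphic Morse lemma with one variable and one parameter: `G(m,σ) = G(φ(σ),σ) + (m − φ(σ))²·e(m,σ)`

Layer `Literature/Geometry/ComplexAnalytic`; theorems only (no definition, no named fact). Written by the prover seat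
`hodge-nonav-prover-Bx` (g21, cell `hodge-nonav`) as brick N4-a of the programme «BRANCH CHART» (memo
`HOME/memos/S5-GLOBAL-ARCHITECTURE-Bx-g21.md` §2) for crux K1Q `VeryGeneralQuaternionCommutatorsInHg` of
`Summits/HodgeConjecture/HodgeConjecture/Theses/Q8SymplecticPowers.lean` (stmt-HodgeConjecture-24190, stub S9, S5-half): the
one-variable parametrised Morse lemma that feeds the EQUIVARIANT `A₃` normal form of the quaternionic quartic branch chart
(`EquivariantA3NormalForm`).

For `G : ℂ × ℂ → ℂ` analytic at `p = (m₀, σ₀)` with `∂_m G(p) = 0` and `∂²_m G(p) ≠ 0`: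

* `hasDerivAt_fst_slice` / `hasDerivAt_snd_slice` — the slices `m ↦ G(m,σ)`, `σ ↦ G(m,σ)` have derivatives `dG(1,0)`, `dG(0,1)`;
* `exists_criticalCurve` — the CRITICAL CURVE `σ ↦ φ(σ)` (analytic at `σ₀`, `φ(σ₀) = m₀`, `∂_m G(φ(σ),σ) = 0` near `σ₀`), by
  Mathlib's implicit function theorem `ContDiffAt.implicitFunction` applied to `∂_m G`;
* `exists_eq_criticalValue_add_sq_mul` — **`G(m,σ) = G(φ(σ),σ) + (m − φ(σ))² · e(m,σ)` near `p` with `e` analytic at `p` and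
  `2·e(p) = ∂²_m G(p) ≠ 0`** (AGZV I §9.6 «Morse lemma with parameters», one variable; Milnor's Lemma 2.2 with a parameter), by two
  divisions by the reduced equation `m − φ(σ)` (the tree's `SCV.exists_eq_smul_of_eqOn_zero`) and Osgood;
* `exists_pow_eq_of_ne_zero` — a non-vanishing analytic germ has an analytic `k`-th root (principal branch);
* `exists_eq_criticalValue_add_sq` — hence `G(m,σ) = G(φ(σ),σ) + W(m,σ)²` with `W` analytic, `W(p) = 0`, `∂_m W(p) ≠ 0`.

Honest scope: local complex analysis; nothing here bears on HC.

## References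

* [ArnoldGuseinZadeVarchenko1985] V. I. Arnold, S. M. Gusein-Zade, A. N. Varchenko, *Singularities of Differentiable Maps* I,
  §9.6 (Morse lemma with parameters).
* [Milnor1963] J. Milnor, *Morse theory*, Lemma 2.2.
* [GriffithsHarris1978] P. Griffiths, J. Harris, *Principles of Algebraic Geometry*, Ch. 0 §1 (implicit function theorem).
* [Rudin1987] W. Rudin, *Real and Complex Analysis*, 3rd ed., Thm. 13.11 (holomorphic logarithms and roots).
-/

noncomputable section

open Filter Set Metric Complex Topology
open scoped ContDiff

namespace Literature.Geometry.ComplexAnalytic.ParametricMorse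

open Literature.Analysis.Complex

/-! ### Slices of a function of two complex variables -/

/-- The slice `m ↦ G (m, σ)` has derivative `dG_{(m,σ)}(1,0)`. [cite: GriffithsHarris1978, Ch. 0 §1] -/
theorem hasDerivAt_fst_slice {G : ℂ × ℂ → ℂ} {z : ℂ × ℂ} (hG : DifferentiableAt ℂ G z) :
    HasDerivAt (fun m => G (m, z.2)) (fderiv ℂ G z (1, 0)) z.1 := by
  have hγ : HasDerivAt (fun m : ℂ => (m, z.2)) (1, 0) z.1 := (hasDerivAt_id z.1).prodMk (hasDerivAt_const z.1 z.2)
  exact hG.hasFDerivAt.comp_hasDerivAt_of_eq z.1 hγ (by simp)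

/-- The slice `σ ↦ G (m, σ)` has derivative `dG_{(m,σ)}(0,1)`. [cite: GriffithsHarris1978, Ch. 0 §1] -/
theorem hasDerivAt_snd_slice {G : ℂ × ℂ → ℂ} {z : ℂ × ℂ} (hG : DifferentiableAt ℂ G z) :
    HasDerivAt (fun σ => G (z.1, σ)) (fderiv ℂ G z (0, 1)) z.2 := by
  have hγ : HasDerivAt (fun σ : ℂ => (z.1, σ)) (0, 1) z.2 := (hasDerivAt_const z.2 z.1).prodMk (hasDerivAt_id z.2)
  exact hG.hasFDerivAt.comp_hasDerivAt_of_eq z.2 hγ (by simp)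

/-- The partial derivative `∂_m G` as a function: `z ↦ dG_z(1,0)` is analytic where `G` is. [cite: GriffithsHarris1978, Ch. 0 §1] -/
theorem analyticAt_partialFst {G : ℂ × ℂ → ℂ} {z : ℂ × ℂ} (hG : AnalyticAt ℂ G z) :
    AnalyticAt ℂ (fun w => fderiv ℂ G w (1, 0)) z :=
  ((ContinuousLinearMap.apply ℂ ℂ ((1 : ℂ), (0 : ℂ))).analyticAt _).comp hG.fderiv

/-- Near an analytic point, `deriv (m ↦ G(m,σ)) m = dG_{(m,σ)}(1,0)`. [cite: GriffithsHarris1978, Ch. 0 §1] -/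
theorem eventually_deriv_fst_slice_eq {G : ℂ × ℂ → ℂ} {z : ℂ × ℂ} (hG : AnalyticAt ℂ G z) :
    ∀ᶠ w in 𝓝 z, deriv (fun m => G (m, w.2)) w.1 = fderiv ℂ G w (1, 0) := by
  filter_upwards [hG.eventually_analyticAt] with w hw
  exact (hasDerivAt_fst_slice hw.differentiableAt).deriv

/-- The second `m`-derivative of the slice through an analytic point is the `m`-derivative of `∂_m G`.
[cite: GriffithsHarris1978, Ch. 0 §1] -/
theorem iteratedDeriv_two_fst_slice {G : ℂ × ℂ → ℂ} {z : ℂ × ℂ} (hG : AnalyticAt ℂ G z) :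
    iteratedDeriv 2 (fun m => G (m, z.2)) z.1 = fderiv ℂ (fun w => fderiv ℂ G w (1, 0)) z (1, 0) := by
  rw [iteratedDeriv_succ, iteratedDeriv_one]
  -- `deriv (m ↦ G(m, z.2))` agrees near `z.1` with `m ↦ ∂_m G (m, z.2)`
  have hcont : ContinuousAt (fun m : ℂ => (m, z.2)) z.1 := (continuous_id.prodMk continuous_const).continuousAt
  have hev : (deriv fun m => G (m, z.2)) =ᶠ[𝓝 z.1] fun m => fderiv ℂ G (m, z.2) (1, 0) := by
    have h := hcont.eventually (show ∀ᶠ w in 𝓝 ((fun m : ℂ => (m, z.2)) z.1), AnalyticAt ℂ G w from hG.eventually_analyticAt)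
    filter_upwards [h] with m hm
    exact (hasDerivAt_fst_slice hm.differentiableAt).deriv
  rw [hev.deriv_eq]
  exact (hasDerivAt_fst_slice (analyticAt_partialFst hG).differentiableAt).deriv

/-! ### The critical curve -/

/-- A `ℂ`-linear map `ℂ → ℂ` with `L 1 ≠ 0` is invertible. [folklore] -/
private theorem isInvertible_of_apply_one_ne_zero (L : ℂ →L[ℂ] ℂ) (h : L 1 ≠ 0) : L.IsInvertible := by
  refine ⟨((LinearEquiv.smulOfNeZero ℂ ℂ (L 1) h).toContinuousLinearEquiv : ℂ ≃L[ℂ] ℂ), ?_⟩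
  apply ContinuousLinearMap.ext_ring
  simp

/-- **The critical curve.** If `G` is analytic at `p = (m₀,σ₀)` with `∂_m G(p) = 0` and `∂²_m G(p) ≠ 0`, there is `φ` analytic
at `σ₀` with `φ σ₀ = m₀` such that, for `σ` near `σ₀`, `G` is analytic at `(φ σ, σ)` and `∂_m G(φ σ, σ) = 0` (implicit function
theorem for `∂_m G`). [cite: ArnoldGuseinZadeVarchenko1985, §9.6] [cite: GriffithsHarris1978, Ch. 0 §1] -/
theorem exists_criticalCurve {G : ℂ × ℂ → ℂ} {p : ℂ × ℂ} (hG : AnalyticAt ℂ G p)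
    (h1 : deriv (fun m => G (m, p.2)) p.1 = 0) (h2 : iteratedDeriv 2 (fun m => G (m, p.2)) p.1 ≠ 0) :
    ∃ φ : ℂ → ℂ, AnalyticAt ℂ φ p.2 ∧ φ p.2 = p.1 ∧
      ∀ᶠ σ in 𝓝 p.2, AnalyticAt ℂ G (φ σ, σ) ∧ deriv (fun m => G (m, σ)) (φ σ) = 0 := by
  -- the partial derivative `Gm` and the implicit equation `f (σ, m) = Gm (m, σ)`
  set Gm : ℂ × ℂ → ℂ := fun w => fderiv ℂ G w (1, 0) with hGm
  have hGm_an : AnalyticAt ℂ Gm p := analyticAt_partialFst hG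
  let sw : ℂ × ℂ → ℂ × ℂ := fun v => (v.2, v.1)
  have hsw : ∀ v, AnalyticAt ℂ sw v := fun v => analyticAt_snd.prod analyticAt_fst
  set f : ℂ × ℂ → ℂ := fun v => Gm (sw v) with hf
  have hu : sw (p.2, p.1) = p := rfl
  have hf_an : AnalyticAt ℂ f (p.2, p.1) := by
    have : AnalyticAt ℂ Gm (sw (p.2, p.1)) := by rw [hu]; exact hGm_an
    exact this.comp (hsw _)
  have cdf : ContDiffAt ℂ ω f (p.2, p.1) := hf_an.contDiffAt
  -- the partial derivative of `f` in `m` at the base point is `∂²_m G (p) ≠ 0`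
  have hfm : fderiv ℂ f (p.2, p.1) (0, 1) = iteratedDeriv 2 (fun m => G (m, p.2)) p.1 := by
    rw [iteratedDeriv_two_fst_slice hG]
    have hd : HasDerivAt (fun m => f (p.2, m)) (fderiv ℂ f (p.2, p.1) (0, 1)) p.1 :=
      hasDerivAt_snd_slice (z := (p.2, p.1)) hf_an.differentiableAt
    have hd' : HasDerivAt (fun m => Gm (m, p.2)) (fderiv ℂ Gm p (1, 0)) p.1 :=
      hasDerivAt_fst_slice (z := p) hGm_an.differentiableAt
    exact hd.unique hd'
  have if₂ : (fderiv ℂ f (p.2, p.1) ∘L ContinuousLinearMap.inr ℂ ℂ ℂ).IsInvertible := by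
    apply isInvertible_of_apply_one_ne_zero
    rw [ContinuousLinearMap.comp_apply, ContinuousLinearMap.inr_apply, hfm]
    exact h2
  have hω : (ω : WithTop ℕ∞) ≠ 0 := by simp
  refine ⟨cdf.implicitFunction hω if₂, (cdf.contDiffAt_implicitFunction hω if₂).analyticAt,
    cdf.implicitFunction_apply_self hω if₂, ?_⟩
  -- near `σ₀`: the implicit equation and analyticity of `G` along the curve
  have hcont : ContinuousAt (cdf.implicitFunction hω if₂) p.2 :=
    (cdf.contDiffAt_implicitFunction hω if₂).continuousAt
  have htend : Tendsto (fun σ => (cdf.implicitFunction hω if₂ σ, σ)) (𝓝 p.2) (𝓝 p) := by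
    have h := hcont.tendsto.prodMk_nhds (continuous_id.tendsto p.2)
    rwa [cdf.implicitFunction_apply_self hω if₂, show ((p.1, id p.2) : ℂ × ℂ) = p from Prod.mk.eta] at h
  filter_upwards [cdf.eventually_apply_implicitFunction hω if₂, htend.eventually hG.eventually_analyticAt]
    with σ hσ han
  refine ⟨han, ?_⟩
  rw [(hasDerivAt_fst_slice (z := (cdf.implicitFunction hω if₂ σ, σ)) han.differentiableAt).deriv]
  have hval : f (p.2, p.1) = 0 := by
    have e := (hasDerivAt_fst_slice (z := p) hG.differentiableAt).deriv
    show fderiv ℂ G (p.1, p.2) (1, 0) = 0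
    rw [show ((p.1, p.2) : ℂ × ℂ) = p from Prod.mk.eta, ← e, h1]
  have h' := hσ
  rw [hval] at h'
  simpa [hf, hGm, sw] using h'

/-! ### Completing the square along the critical curve -/

/-- **Parametrised Morse lemma in one variable** (AGZV I §9.6; Milnor's Lemma 2.2 with a holomorphic parameter). If
`G : ℂ × ℂ → ℂ` is analytic at `p = (m₀,σ₀)` with `∂_m G(p) = 0` and `∂²_m G(p) ≠ 0`, then with the critical curve `φ` of
`exists_criticalCurve` there is `e` analytic at `p` with `2·e(p) = ∂²_m G(p)` and, near `p`,
`G(m,σ) = G(φ σ, σ) + (m − φ σ)² · e(m,σ)`. (Two divisions by the reduced equation `m − φ(σ)` of the critical curve.)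
[cite: ArnoldGuseinZadeVarchenko1985, §9.6] [cite: Milnor1963, Lemma 2.2] -/
theorem exists_eq_criticalValue_add_sq_mul {G : ℂ × ℂ → ℂ} {p : ℂ × ℂ} (hG : AnalyticAt ℂ G p)
    (h1 : deriv (fun m => G (m, p.2)) p.1 = 0) (h2 : iteratedDeriv 2 (fun m => G (m, p.2)) p.1 ≠ 0) :
    ∃ (φ : ℂ → ℂ) (e : ℂ × ℂ → ℂ), AnalyticAt ℂ φ p.2 ∧ φ p.2 = p.1 ∧ AnalyticAt ℂ e p ∧
      2 * e p = iteratedDeriv 2 (fun m => G (m, p.2)) p.1 ∧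
      ∀ᶠ z in 𝓝 p, AnalyticAt ℂ G z ∧ AnalyticAt ℂ G (φ z.2, z.2) ∧ AnalyticAt ℂ φ z.2 ∧ AnalyticAt ℂ e z ∧
        deriv (fun m => G (m, z.2)) (φ z.2) = 0 ∧ G z = G (φ z.2, z.2) + (z.1 - φ z.2) ^ 2 * e z := by
  obtain ⟨φ, hφ, hφ0, hev⟩ := exists_criticalCurve hG h1 h2
  -- an open product-like neighbourhood `U` of `p` on which everything is defined
  obtain ⟨V, hVsub, hVopen, hpV⟩ := _root_.mem_nhds_iff.1 (hev.and hφ.eventually_analyticAt)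
  have hV : ∀ σ ∈ V, (AnalyticAt ℂ G (φ σ, σ) ∧ deriv (fun m => G (m, σ)) (φ σ) = 0) ∧ AnalyticAt ℂ φ σ :=
    fun σ hσ => hVsub hσ
  set U : Set (ℂ × ℂ) := {z | AnalyticAt ℂ G z} ∩ Prod.snd ⁻¹' V with hUdef
  have hU : IsOpen U := (isOpen_analyticAt ℂ G).inter (hVopen.preimage continuous_snd)
  have hpU : p ∈ U := ⟨hG, hpV⟩
  -- the reduced equation `t` of the critical curve and `f₁ = G − G ∘ (critical curve)`
  set t : ℂ × ℂ → ℂ := fun z => z.1 - φ z.2 with htdef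
  set f₁ : ℂ × ℂ → ℂ := fun z => G z - G (φ z.2, z.2) with hf₁def
  have hcurve : ∀ z ∈ U, DifferentiableAt ℂ (fun w : ℂ × ℂ => (φ w.2, w.2)) z := fun z hz =>
    ((hV z.2 hz.2).2.differentiableAt.comp z differentiableAt_snd).prodMk differentiableAt_snd
  have ht : DifferentiableOn ℂ t U := fun z hz =>
    (differentiableAt_fst.sub ((hV z.2 hz.2).2.differentiableAt.comp z differentiableAt_snd)).differentiableWithinAt
  have hf₁ : DifferentiableOn ℂ f₁ U := fun z hz =>
    (hz.1.differentiableAt.sub ((hV z.2 hz.2).1.1.differentiableAt.comp z (hcurve z hz))).differentiableWithinAt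
  have hdt : ∀ z ∈ U, t z = 0 → fderiv ℂ t z ≠ 0 := by
    intro z hz _ h0
    have hd : HasFDerivAt t (ContinuousLinearMap.fst ℂ ℂ ℂ - (fderiv ℂ φ z.2).comp (ContinuousLinearMap.snd ℂ ℂ ℂ)) z :=
      hasFDerivAt_fst.sub (((hV z.2 hz.2).2.differentiableAt.hasFDerivAt).comp z hasFDerivAt_snd)
    have h := congrArg (fun L : ℂ × ℂ →L[ℂ] ℂ => L (1, 0)) (hd.fderiv.symm.trans h0)
    simp at h
  have hft : ∀ z ∈ U, t z = 0 → f₁ z = 0 := by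
    intro z _ h0
    have h : z.1 = φ z.2 := sub_eq_zero.1 h0
    simp only [hf₁def, ← h, Prod.mk.eta, sub_self]
  -- first division
  obtain ⟨H, hH, hfH⟩ := SCV.exists_eq_smul_of_eqOn_zero hU ht hf₁ hdt hft
  -- `H` vanishes on the critical curve: differentiate `G(m,σ) − G(φσ,σ) = (m − φσ)·H(m,σ)` in `m` at `m = φ σ`
  have hHt : ∀ z ∈ U, t z = 0 → H z = 0 := by
    rintro ⟨m₁, σ⟩ hz h0
    have hm₁ : m₁ = φ σ := sub_eq_zero.1 h0
    have hline : ∀ᶠ m in 𝓝 m₁, ((m, σ) : ℂ × ℂ) ∈ U :=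
      (continuous_id.prodMk continuous_const).continuousAt.preimage_mem_nhds (hU.mem_nhds hz)
    have heq : (fun m => (m - φ σ) * H (m, σ)) =ᶠ[𝓝 m₁] fun m => G (m, σ) - G (φ σ, σ) :=
      hline.mono fun m hm => by simpa [hf₁def, htdef, smul_eq_mul] using (hfH (m, σ) hm).symm
    have dH : HasDerivAt (fun m => H (m, σ)) (fderiv ℂ H (m₁, σ) (1, 0)) m₁ :=
      hasDerivAt_fst_slice (z := (m₁, σ)) (hH.differentiableAt (hU.mem_nhds hz))
    have dR : HasDerivAt (fun m => G (m, σ) - G (φ σ, σ))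
        (1 * H (m₁, σ) + (m₁ - φ σ) * fderiv ℂ H (m₁, σ) (1, 0)) m₁ :=
      ((((hasDerivAt_id m₁).sub_const (φ σ)).mul dH).congr_of_eventuallyEq heq.symm)
    have dL : HasDerivAt (fun m => G (m, σ) - G (φ σ, σ)) (fderiv ℂ G (m₁, σ) (1, 0)) m₁ :=
      (hasDerivAt_fst_slice (z := (m₁, σ)) hz.1.differentiableAt).sub_const _
    have hcrit : fderiv ℂ G (m₁, σ) (1, 0) = 0 := by
      rw [← (hasDerivAt_fst_slice (z := (m₁, σ)) hz.1.differentiableAt).deriv]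
      simpa [hm₁] using (hV σ hz.2).1.2
    have h := dL.unique dR
    rw [hcrit, hm₁, sub_self, zero_mul, add_zero, one_mul] at h
    simpa [hm₁] using h.symm
  -- second division
  obtain ⟨e, he, hHe⟩ := SCV.exists_eq_smul_of_eqOn_zero hU ht hH hdt hHt
  have he_an : ∀ z ∈ U, AnalyticAt ℂ e z := fun z hz => HolomorphicBanach.analyticAt_of_differentiableOn he hU hz
  have hGe : ∀ z ∈ U, G z = G (φ z.2, z.2) + (z.1 - φ z.2) ^ 2 * e z := by
    intro z hz
    have h := hfH z hz
    rw [hHe z hz] at h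
    simp only [hf₁def, htdef, smul_eq_mul] at h
    linear_combination h
  -- `2 e(p) = ∂²_m G(p)`: second derivative of `m ↦ (m − m₀)²·e(m,σ₀)` at `m₀`
  have h2e : 2 * e p = iteratedDeriv 2 (fun m => G (m, p.2)) p.1 := by
    set m₀ := p.1 with hm₀
    set σ₀ := p.2 with hσ₀
    have hpp : ((m₀, σ₀) : ℂ × ℂ) = p := Prod.mk.eta
    set e₁ : ℂ → ℂ := fun m => e (m, σ₀) with he₁
    have he₁an : AnalyticAt ℂ e₁ m₀ := by
      have h : AnalyticAt ℂ e (m₀, σ₀) := by rw [hpp]; exact he_an p hpU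
      exact h.comp_of_eq (analyticAt_id.prod analyticAt_const) rfl
    have hline : ∀ᶠ m in 𝓝 m₀, ((m, σ₀) : ℂ × ℂ) ∈ U :=
      (continuous_id.prodMk continuous_const).continuousAt.preimage_mem_nhds
        (by simpa only [id, hpp] using hU.mem_nhds hpU)
    -- `G(m,σ₀) = G(m₀,σ₀) + (m − m₀)²·e₁ m` near `m₀`
    have hq : (fun m => G (m, σ₀)) =ᶠ[𝓝 m₀] fun m => G (m₀, σ₀) + (m - m₀) ^ 2 * e₁ m :=
      hline.mono fun m hm => by have h := hGe (m, σ₀) hm; rwa [hφ0] at h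
    rw [iteratedDeriv_succ, iteratedDeriv_one, (hq.deriv).deriv_eq]
    -- first derivative near `m₀`
    have hd1 : deriv (fun m => G (m₀, σ₀) + (m - m₀) ^ 2 * e₁ m) =ᶠ[𝓝 m₀]
        fun m => 2 * (m - m₀) * e₁ m + (m - m₀) ^ 2 * deriv e₁ m := by
      filter_upwards [he₁an.eventually_analyticAt] with m hm
      have hd : HasDerivAt (fun m => G (m₀, σ₀) + (m - m₀) ^ 2 * e₁ m)
          (0 + (((2 : ℕ) : ℂ) * (m - m₀) ^ (2 - 1) * 1 * e₁ m + (m - m₀) ^ 2 * deriv e₁ m)) m :=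
        (hasDerivAt_const m _).add ((((hasDerivAt_id m).sub_const m₀).pow 2).mul hm.differentiableAt.hasDerivAt)
      rw [hd.deriv]
      simp
    rw [hd1.deriv_eq]
    have hd2 : HasDerivAt (fun m => 2 * (m - m₀) * e₁ m + (m - m₀) ^ 2 * deriv e₁ m)
        ((2 * 1 * e₁ m₀ + 2 * (m₀ - m₀) * deriv e₁ m₀) +
          (((2 : ℕ) : ℂ) * (m₀ - m₀) ^ (2 - 1) * 1 * deriv e₁ m₀ + (m₀ - m₀) ^ 2 * deriv (deriv e₁) m₀)) m₀ :=
      ((((hasDerivAt_id m₀).sub_const m₀).const_mul 2).mul he₁an.differentiableAt.hasDerivAt).add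
        ((((hasDerivAt_id m₀).sub_const m₀).pow 2).mul he₁an.deriv.differentiableAt.hasDerivAt)
    rw [hd2.deriv]
    simp [he₁, hpp]
  refine ⟨φ, e, hφ, hφ0, he_an p hpU, h2e, ?_⟩
  filter_upwards [hU.mem_nhds hpU] with z hz
  exact ⟨hz.1, (hV z.2 hz.2).1.1, (hV z.2 hz.2).2, he_an z hz, (hV z.2 hz.2).1.2, hGe z hz⟩

/-! ### Analytic roots of units, and the coordinate `W = (m − φ σ)·√e` -/

/-- A non-vanishing analytic germ has an analytic `k`-th root (`k ≠ 0`): `q^k = f` near `x`, `q x ≠ 0` (principal branch of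
`(f/f(x))^{1/k}` times a `k`-th root of `f(x)`). [cite: Rudin1987, Thm. 13.11] -/
theorem exists_pow_eq_of_ne_zero {E : Type*} [NormedAddCommGroup E] [NormedSpace ℂ E] {f : E → ℂ} {x : E}
    (hf : AnalyticAt ℂ f x) (h0 : f x ≠ 0) {k : ℕ} (hk : k ≠ 0) :
    ∃ q : E → ℂ, AnalyticAt ℂ q x ∧ q x ≠ 0 ∧ ∀ᶠ y in 𝓝 x, AnalyticAt ℂ q y ∧ q y ^ k = f y := by
  obtain ⟨κ, hκ⟩ := IsAlgClosed.exists_pow_nat_eq (f x) (Nat.pos_of_ne_zero hk)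
  have hκ0 : κ ≠ 0 := by
    rintro rfl
    rw [zero_pow hk] at hκ
    exact h0 hκ.symm
  set q : E → ℂ := fun y => κ * (f y / f x) ^ ((k : ℂ)⁻¹) with hq
  -- `f y / f x` stays in the slit plane near `x`
  have hslit : ∀ᶠ y in 𝓝 x, f y / f x ∈ slitPlane := by
    have hc : ContinuousAt (fun y => f y / f x) x := hf.continuousAt.div_const _
    have h1 : (fun y => f y / f x) x = 1 := div_self h0
    have hmem : slitPlane ∈ 𝓝 ((fun y => f y / f x) x) := by
      rw [h1]; exact isOpen_slitPlane.mem_nhds one_mem_slitPlane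
    exact hc.preimage_mem_nhds hmem
  have han : ∀ᶠ y in 𝓝 x, AnalyticAt ℂ q y := by
    filter_upwards [hf.eventually_analyticAt, hslit] with y hy hys
    exact analyticAt_const.mul ((hy.div analyticAt_const h0).cpow analyticAt_const hys)
  refine ⟨q, han.self_of_nhds, ?_, ?_⟩
  · simp [hq, div_self h0, hκ0]
  · filter_upwards [han] with y hy
    refine ⟨hy, ?_⟩
    rw [hq]; dsimp only
    rw [mul_pow, hκ, cpow_nat_inv_pow _ hk, mul_div_cancel₀ _ h0]

/-- **The Morse coordinate along the critical curve.** Under the hypotheses of `exists_eq_criticalValue_add_sq_mul` there are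
`φ` (the critical curve) and `W` analytic at `p` with `W p = 0`, `∂_m W(p) ≠ 0`, and `G(m,σ) = G(φ σ, σ) + W(m,σ)²` near `p`;
moreover `W = (m − φ σ)·r(m,σ)` with `r` analytic and `r p ≠ 0`. [cite: ArnoldGuseinZadeVarchenko1985, §9.6] [cite: Milnor1963, Lemma 2.2] -/
theorem exists_eq_criticalValue_add_sq {G : ℂ × ℂ → ℂ} {p : ℂ × ℂ} (hG : AnalyticAt ℂ G p)
    (h1 : deriv (fun m => G (m, p.2)) p.1 = 0) (h2 : iteratedDeriv 2 (fun m => G (m, p.2)) p.1 ≠ 0) :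
    ∃ (φ : ℂ → ℂ) (r : ℂ × ℂ → ℂ), AnalyticAt ℂ φ p.2 ∧ φ p.2 = p.1 ∧ AnalyticAt ℂ r p ∧ r p ≠ 0 ∧
      ∀ᶠ z in 𝓝 p, AnalyticAt ℂ G z ∧ AnalyticAt ℂ G (φ z.2, z.2) ∧ AnalyticAt ℂ φ z.2 ∧ AnalyticAt ℂ r z ∧
        deriv (fun m => G (m, z.2)) (φ z.2) = 0 ∧ G z = G (φ z.2, z.2) + ((z.1 - φ z.2) * r z) ^ 2 := by
  obtain ⟨φ, e, hφ, hφ0, he, h2e, hev⟩ := exists_eq_criticalValue_add_sq_mul hG h1 h2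
  have he0 : e p ≠ 0 := by
    intro h
    rw [h, mul_zero] at h2e
    exact h2 h2e.symm
  obtain ⟨r, hr, hr0, hrev⟩ := exists_pow_eq_of_ne_zero he he0 two_ne_zero
  refine ⟨φ, r, hφ, hφ0, hr, hr0, ?_⟩
  filter_upwards [hev, hrev] with z hz hrz
  refine ⟨hz.1, hz.2.1, hz.2.2.1, hrz.1, hz.2.2.2.2.1, ?_⟩
  rw [mul_pow, hrz.2]
  exact hz.2.2.2.2.2

end Literature.Geometry.ComplexAnalytic.ParametricMorse
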